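import Summits.ResolutionOfSingularities.ResolutionOfSingularities.Theorems.ProximityCutClasses
import HarnessLib

/-!
# ProximityCutAxis — THE AXIS LAW `NoAxisTails` PROVED IN LEAN (lens §4) and the chart-exponent / axis-map calculus
(lens-3 g12 node «ProximityCut» rev 3a (sha256 3a2d1668… = rev 3 e1d6297007058045 + lint fix :1743);
CRITIC-LEDGER rows 79 / 83 / 84 (CLEARED, CLEARED-REV, CLEARED-REV3))

[WRITER NOTE (decomp-res writer g5).  Lens §4 (:519–:828) VERBATIM (`section Axis`: `degree_erase_add`, `chartExponent_*`,
`coeff_chartTransform_chartExponent`, `le_degree_of_mem_support`, `st_succ_F_axis`, `no_thin_monomial`,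
`fat_of_axis_tail`, `axisMap`, `aeval_axisMap_hasseDeriv_eq_zero`, `noAxisTails_holds`, `noAxisTails_deep`).  Critic
rows 79/84: this is an independent second proof of lens-5 g13's `LassoCut.no_axis_tail` (landed
`Theorems.LassoCutAxisTails`, credit lens-5); it is filed because its calculus is the substrate of the corner and origin
cuts (`ProximityCutCorner`, `ProximityCutOrigin`); NO second axis ITEM is booked on the route (R1).  0 sorry; one
support definition `axisMap`.] (Sources: Hauser2010 §§F–G; Moh1987.)
-/

open MvPolynomial
open Literature.AlgebraicGeometry.Resolution
open Literature.AlgebraicGeometry.Resolution.Hauser2010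
open Literature.AlgebraicGeometry.Resolution.PointBlowup
open Summit.ResolutionOfSingularities.ResolutionOfSingularities.Theorems.TightDefectClasses
open Summit.ResolutionOfSingularities.ResolutionOfSingularities.Theorems.TightDefectStrongWalks
open Summit.ResolutionOfSingularities.ResolutionOfSingularities.Theorems.ItineraryCutClasses
open Summit.ResolutionOfSingularities.ResolutionOfSingularities.Theorems.BoundaryLedger

namespace Summit.ResolutionOfSingularities.ResolutionOfSingularities.Theorems.ProximityCut

/-! ## §4 THE AXIS LAW — PROVED IN LEAN (the arc law's case «Γ = the `u_j`-axis», no power series needed;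
independent second proof of lens-5 g13 `LassoCut.no_axis_tail`, see the priority note in the header) -/

section Axis

variable {K : Type} [Field K] [DecidableEq K] {q : ℕ} {s₀ : State (Fin 3) K}

/-- `|d| = |d off j| + d_j`. [folklore] -/
theorem degree_erase_add (d : Fin 3 →₀ ℕ) (j : Fin 3) : (Finsupp.erase j d).degree + d j = d.degree := by
  conv_rhs => rw [← Finsupp.erase_add_single j d]
  rw [map_add, Finsupp.degree_single]

/-- The chart exponent keeps the off-`j` part. [folklore] -/
theorem chartExponent_erase (q : ℕ) (j : Fin 3) (d : Fin 3 →₀ ℕ) :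
    Finsupp.erase j (chartExponent q j d) = Finsupp.erase j d := by
  classical
  ext i
  by_cases hij : i = j
  · rw [hij, Finsupp.erase_same, Finsupp.erase_same]
  · rw [Finsupp.erase_ne hij, Finsupp.erase_ne hij]
    unfold chartExponent
    rw [Finsupp.coe_update, Function.update_of_ne hij]

/-- … and puts `|d| − q` on `j`. [folklore] -/
theorem chartExponent_self (q : ℕ) (j : Fin 3) (d : Fin 3 →₀ ℕ) : chartExponent q j d j = d.degree - q := by
  classical
  unfold chartExponent
  rw [Finsupp.coe_update, Function.update_self]

/-- The chart exponent map is injective on exponents of degree `≥ q`. [folklore] -/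
theorem chartExponent_injOn {q : ℕ} {j : Fin 3} {d d' : Fin 3 →₀ ℕ} (hd : q ≤ d.degree) (hd' : q ≤ d'.degree)
    (h : chartExponent q j d = chartExponent q j d') : d = d' := by
  have h1 : Finsupp.erase j d = Finsupp.erase j d' := by
    rw [← chartExponent_erase q j d, h, chartExponent_erase]
  have h2 : d.degree = d'.degree := by
    have := congrArg (fun c : Fin 3 →₀ ℕ => c j) h
    simp only [chartExponent_self] at this
    omega
  have h3 : d j = d' j := by
    have e1 := degree_erase_add d j
    have e2 := degree_erase_add d' j
    rw [h1] at e1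
    omega
  rw [← Finsupp.erase_add_single j d, ← Finsupp.erase_add_single j d', h1, h3]

omit [DecidableEq K] in
/-- Coefficient transport through the chart (no collisions above degree `q`). [folklore] -/
theorem coeff_chartTransform_chartExponent {q : ℕ} {j : Fin 3} (F : MvPolynomial (Fin 3) K)
    (hF : ∀ d ∈ F.support, q ≤ d.degree) {d : Fin 3 →₀ ℕ} (hd : d ∈ F.support) :
    coeff (chartExponent q j d) (chartTransform q j F) = coeff d F := by
  classical
  unfold chartTransform
  rw [coeff_sum]
  simp_rw [coeff_monomial]
  rw [Finset.sum_eq_single d]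
  · rw [if_pos rfl]
  · intro d' hd' hne
    rw [if_neg]
    intro h
    exact hne (chartExponent_injOn (hF d' hd') (hF d hd) h)
  · intro h
    exact absurd hd h

omit [DecidableEq K] in
/-- Translating by the origin does nothing. [folklore] -/
theorem translate_zero_eq (G : MvPolynomial (Fin 3) K) : PointBlowup.translate (0 : Fin 3 → K) G = G := by
  unfold PointBlowup.translate
  have h : (fun i : Fin 3 => X i + C ((0 : Fin 3 → K) i)) = (X : Fin 3 → MvPolynomial (Fin 3) K) := by
    funext i
    simp
  rw [h, MvPolynomial.aeval_X_left_apply]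

/-- Along a walk from a root every monomial has degree `≥ q`. [folklore] -/
theorem le_degree_of_mem_support (hs : IsRoot q s₀) (W : ForcedWalk q s₀) (t : ℕ) {d : Fin 3 →₀ ℕ}
    (hd : d ∈ (W.st t).F.support) : q ≤ d.degree := by
  by_contra hlt
  push Not at hlt
  exact (mem_support_iff.mp hd)
    (coeff_eq_zero_of_degree_lt_ordZero (lt_of_lt_of_le (by exact_mod_cast hlt) (walk_ord hs W t)))

/-- … and is not a `q`-th power (the states are cleaned). [folklore] -/
theorem not_isPthPowerExponent_of_mem_support (hs : IsRoot q s₀) (W : ForcedWalk q s₀) (t : ℕ)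
    {d : Fin 3 →₀ ℕ} (hd : d ∈ (W.st t).F.support) : ¬ IsPthPowerExponent q d := by
  classical
  intro hP
  have h := congrArg (coeff d) (walk_clean hs W t)
  rw [coeff_deletePthPowers, if_pos hP] at h
  exact (mem_support_iff.mp hd) h.symm

/-- The step at the origin of chart `j`: no translation. [folklore] -/
theorem st_succ_F_axis (W : ForcedWalk q s₀) (t : ℕ) {j : Fin 3} (hj : W.j t = j) (hb : W.b t = 0) :
    (W.st (t + 1)).F = deletePthPowers q (chartTransform q j (W.st t).F) := by
  rw [W.st_succ]
  show deletePthPowers q (PointBlowup.translate (W.b t) (chartTransform q (W.j t) (W.st t).F)) = _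
  rw [hb, hj, translate_zero_eq]

/-- Equimultiplicity at the origin of chart `j`: the chart transform has no monomial of degree `1 … q−1`.
[folklore] -/
theorem coeff_chartTransform_eq_zero_axis (W : ForcedWalk q s₀) (t : ℕ) {j : Fin 3} (hj : W.j t = j)
    (hb : W.b t = 0) {c : Fin 3 →₀ ℕ} (hc0 : c ≠ 0) (hc : c.degree < q) :
    coeff c (chartTransform q j (W.st t).F) = 0 := by
  have h := W.equimult t c hc0 hc
  change coeff c (PointBlowup.translate (W.b t) (chartTransform q (W.j t) (W.st t).F)) = 0 at h
  rwa [hb, hj, translate_zero_eq] at h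

/-- An exponent with no off-`j` part is a pure `u_j`-power. [folklore] -/
theorem eq_single_of_erase_eq_zero {j : Fin 3} {d : Fin 3 →₀ ℕ} (h : Finsupp.erase j d = 0) :
    d = Finsupp.single j (d j) := by
  rw [← Finsupp.erase_add_single j d, h, zero_add, Finsupp.single_eq_same]

/-- A pure `u_j`-power is a `q`-th power exponent iff `q ∣` the exponent. [folklore] -/
theorem isPthPowerExponent_single_iff {j : Fin 3} {k : ℕ} (hk : k ≠ 0) :
    IsPthPowerExponent q (Finsupp.single j k) ↔ q ∣ k := by
  classical
  constructor
  · intro h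
    have := h j (by rw [Finsupp.mem_support_iff, Finsupp.single_eq_same]; exact hk)
    rwa [Finsupp.single_eq_same] at this
  · intro h i hi
    have hij : i = j := by
      by_contra hij
      rw [Finsupp.mem_support_iff, Finsupp.single_apply] at hi
      exact hi (if_neg fun h' => hij h'.symm)
    rw [hij, Finsupp.single_eq_same]
    exact h

/-- **MONOMIAL DESCENT (PROVED).**  Along a tail at the origin of the fixed chart `j`, no monomial of off-`j`
degree `< q` can occur: its `u_j`-exponent would drop by `q − α ≥ 1` at every step (it is never deleted — it is
not a `q`-th power — and never collides), until its total degree falls below `q`, contradicting equimultiplicity.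
Induction on the `u_j`-exponent (`q ≥ 1` is implied by the thinness hypothesis). [folklore] -/
theorem no_thin_monomial (hs : IsRoot q s₀) (W : ForcedWalk q s₀) {N : ℕ} {j : Fin 3}
    (hN : ∀ t, N ≤ t → W.j t = j ∧ W.b t = 0) :
    ∀ m t : ℕ, N ≤ t → ∀ d ∈ (W.st t).F.support, (Finsupp.erase j d).degree < q → d j ≤ m → False := by
  classical
  intro m
  induction m with
  | zero =>
    intro t ht d hd hα hm
    have h1 := le_degree_of_mem_support hs W t hd
    have h2 := degree_erase_add d j
    omega
  | succ m ih =>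
    intro t ht d hd hα hm
    have hdeg : q ≤ d.degree := le_degree_of_mem_support hs W t hd
    have hsum := degree_erase_add d j
    have hd0 : coeff d (W.st t).F ≠ 0 := mem_support_iff.mp hd
    have hall : ∀ d' ∈ (W.st t).F.support, q ≤ d'.degree := fun d' hd' => le_degree_of_mem_support hs W t hd'
    have hcoeff := coeff_chartTransform_chartExponent (q := q) (j := j) _ hall hd
    have hcer : Finsupp.erase j (chartExponent q j d) = Finsupp.erase j d := chartExponent_erase q j d
    have hcj : chartExponent q j d j = d.degree - q := chartExponent_self q j d
    have hcsum := degree_erase_add (chartExponent q j d) j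
    have hndvd : ¬ IsPthPowerExponent q d := not_isPthPowerExponent_of_mem_support hs W t hd
    by_cases hlt : (chartExponent q j d).degree < q
    · by_cases hc0 : chartExponent q j d = 0
      · -- then `d = q·e_j`, a `q`-th power: excluded by cleanliness
        have hα0 : Finsupp.erase j d = 0 := by rw [← hcer, hc0, Finsupp.erase_zero]
        have hα0' : (Finsupp.erase j d).degree = 0 := by rw [hα0, map_zero]
        have hjq : d j = q := by
          have := congrArg (fun c : Fin 3 →₀ ℕ => c j) hc0
          simp only [hcj, Finsupp.coe_zero, Pi.zero_apply] at this
          omega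
        have hdj : d = Finsupp.single j q := by rw [eq_single_of_erase_eq_zero hα0, hjq]
        refine hndvd ?_
        rw [hdj]
        exact (isPthPowerExponent_single_iff (by omega)).mpr (dvd_refl q)
      · exact hd0 (hcoeff.symm.trans (coeff_chartTransform_eq_zero_axis W t (hN t ht).1 (hN t ht).2 hc0 hlt))
    · push Not at hlt
      -- the transformed monomial survives the cleaning …
      have hnP : ¬ IsPthPowerExponent q (chartExponent q j d) := by
        by_cases hα : Finsupp.erase j d = 0
        · -- pure `u_j`-power before and after
          have hα' : (Finsupp.erase j d).degree = 0 := by rw [hα, map_zero]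
          have hdj : d = Finsupp.single j (d j) := eq_single_of_erase_eq_zero hα
          have hcsingle : chartExponent q j d = Finsupp.single j (chartExponent q j d j) :=
            eq_single_of_erase_eq_zero (by rw [hcer, hα])
          have hcer' : (Finsupp.erase j (chartExponent q j d)).degree = 0 := by rw [hcer, hα']
          have hjpos : d j ≠ 0 := by omega
          have hcjpos : chartExponent q j d j ≠ 0 := by omega
          rw [hcsingle, isPthPowerExponent_single_iff hcjpos, hcj]
          intro hdvd
          refine hndvd ?_
          rw [hdj, isPthPowerExponent_single_iff hjpos]
          have : d j = d.degree - q + q := by omega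
          rw [this]
          exact dvd_add hdvd (dvd_refl q)
        · -- some off-`j` exponent lies strictly between `0` and `q`
          obtain ⟨i, hi⟩ : ∃ i, Finsupp.erase j d i ≠ 0 := by
            by_contra hnone
            push Not at hnone
            exact hα (Finsupp.ext hnone)
          have hij : i ≠ j := by
            rintro rfl
            exact hi Finsupp.erase_same
          have hci : chartExponent q j d i = d i := by
            have := congrArg (fun c : Fin 3 →₀ ℕ => c i) hcer
            simp only [Finsupp.erase_ne hij] at this
            exact this
          have hdi : d i ≠ 0 := by rwa [Finsupp.erase_ne hij] at hi
          have hdi_le : d i ≤ (Finsupp.erase j d).degree := by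
            have := Finsupp.le_degree i (Finsupp.erase j d)
            rwa [Finsupp.erase_ne hij] at this
          intro hP
          have hdvd := hP i (by rw [Finsupp.mem_support_iff, hci]; exact hdi)
          rw [hci] at hdvd
          exact Nat.not_dvd_of_pos_of_lt (Nat.pos_of_ne_zero hdi) (by omega) hdvd
      have hcF : coeff (chartExponent q j d) (W.st (t + 1)).F = coeff d (W.st t).F := by
        rw [st_succ_F_axis W t (hN t ht).1 (hN t ht).2, coeff_deletePthPowers, if_neg hnP, hcoeff]
      have hc_supp : chartExponent q j d ∈ (W.st (t + 1)).F.support := by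
        rw [mem_support_iff, hcF]
        exact hd0
      have hαc : (Finsupp.erase j (chartExponent q j d)).degree < q := by rw [hcer]; exact hα
      exact ih (t + 1) (by omega) _ hc_supp hαc (by omega)

/-- CONSEQUENCE (PROVED): on an axis tail every monomial of every state is FAT (`u`-off-`j` degree `≥ q`), i.e.
`F_t ∈ (u_i, u_{i'})^q` — the residual contains the `u_j`-AXIS in its multiplicity-`q` locus. [folklore] -/
theorem fat_of_axis_tail (hs : IsRoot q s₀) (W : ForcedWalk q s₀) {N : ℕ} {j : Fin 3}
    (hN : ∀ t, N ≤ t → W.j t = j ∧ W.b t = 0) {t : ℕ} (ht : N ≤ t) :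
    ∀ d ∈ (W.st t).F.support, q ≤ (Finsupp.erase j d).degree := by
  intro d hd
  by_contra hlt
  push Not at hlt
  exact no_thin_monomial hs W hN (d j) t ht d hd hlt le_rfl

/-- The substitution `u_i ↦ 0 (i ≠ j)`, `u_j ↦ u_j` (restriction to the `u_j`-axis).  DEFINITION (support). -/
noncomputable def axisMap (K : Type) [Field K] (j : Fin 3) : Fin 3 → MvPolynomial (Fin 3) K :=
  fun i => if i = j then X j else 0

omit [DecidableEq K] in
/-- Restriction to the axis preserves the constant term. [folklore] -/
theorem constantCoeff_aeval_axisMap (j : Fin 3) (g : MvPolynomial (Fin 3) K) :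
    constantCoeff (aeval (axisMap K j) g) = constantCoeff g := by
  induction g using MvPolynomial.induction_on with
  | C a =>
    rw [aeval_C, MvPolynomial.algebraMap_eq]
  | add p p' hp hp' =>
    simp only [map_add, hp, hp']
  | mul_X p i hp =>
    rw [map_mul, aeval_X, map_mul, map_mul, constantCoeff_X, mul_zero]
    unfold axisMap
    split_ifs
    · rw [constantCoeff_X, mul_zero]
    · rw [map_zero, mul_zero]

/-- **HASSE STEP (PROVED).**  If every monomial of `F` is fat off `j`, every Hasse derivative `∂^{(c)} F` with
`|c| < q` vanishes on the `u_j`-axis (`coeff_hasseDeriv`: its pure-`u_j` coefficients are coefficients of `F` at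
exponents of off-`j` degree `≤ |c| < q`). [folklore] -/
theorem aeval_axisMap_hasseDeriv_eq_zero (j : Fin 3) (F : MvPolynomial (Fin 3) K)
    (hfat : ∀ d ∈ F.support, q ≤ (Finsupp.erase j d).degree) (c : Fin 3 →₀ ℕ) (hc : c.degree < q) :
    aeval (axisMap K j) (hasseDeriv K c F) = 0 := by
  classical
  rw [(hasseDeriv K c F).as_sum, map_sum]
  refine Finset.sum_eq_zero fun β hβ => ?_
  rw [aeval_monomial]
  by_cases hoff : ∃ i ∈ β.support, i ≠ j
  · obtain ⟨i, hi, hij⟩ := hoff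
    rw [Finsupp.prod, Finset.prod_eq_zero hi, mul_zero]
    unfold axisMap
    rw [if_neg hij, zero_pow (Finsupp.mem_support_iff.mp hi)]
  · exfalso
    push Not at hoff
    have hβ' : Finsupp.erase j β = 0 := by
      ext i
      by_cases hij : i = j
      · rw [hij, Finsupp.erase_same, Finsupp.coe_zero, Pi.zero_apply]
      · rw [Finsupp.erase_ne hij, Finsupp.coe_zero, Pi.zero_apply]
        exact Finsupp.notMem_support_iff.mp fun hi => hij (hoff i hi)
    have hcoef := coeff_hasseDeriv c β F
    have hzero : coeff (c + β) F = 0 := by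
      by_contra hne
      have h1 := hfat (c + β) (mem_support_iff.mpr hne)
      rw [Finsupp.erase_add, hβ', add_zero] at h1
      have h2 := degree_erase_add c j
      omega
    rw [hzero, mul_zero] at hcoef
    exact (mem_support_iff.mp hβ) hcoef

/-- **THE AXIS LAW, PROVED** (`NoAxisTails`): fatness (monomial descent) puts every `∂^{(c)} F_N`, `|c| < q`,
in the kernel of the restriction to the `u_j`-axis, hence the whole top-locus ideal; isolation gives
`g · u_j^{N₀}` in it with `g(0) ≠ 0`, but its restriction `g|_{axis} · u_j^{N₀}` vanishes, so `g(0) = 0`. [folklore] -/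
theorem noAxisTails_holds : NoAxisTails := by
  intro p hp e he K _ _ _ _ s₀ hs W N j hN
  classical
  have hfat : ∀ d ∈ (W.st N).F.support, p ^ e ≤ (Finsupp.erase j d).degree := fat_of_axis_tail hs W hN le_rfl
  obtain ⟨N₀, g, hg0, hg⟩ := W.isolated N
  have hker : topIdeal (p ^ e) (W.st N).F ≤ RingHom.ker (aeval (axisMap K j)).toRingHom := by
    unfold topIdeal
    rw [Ideal.span_le]
    rintro _ ⟨c, ⟨-, hc⟩, rfl⟩
    rw [SetLike.mem_coe, RingHom.mem_ker]
    exact aeval_axisMap_hasseDeriv_eq_zero j _ hfat c hc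
  have h0 := hker (hg j)
  rw [RingHom.mem_ker] at h0
  change aeval (axisMap K j) (g * X j ^ N₀) = 0 at h0
  rw [map_mul, map_pow, aeval_X] at h0
  have hX : axisMap K j j = X j := by unfold axisMap; rw [if_pos rfl]
  rw [hX] at h0
  have hg' : aeval (axisMap K j) g = 0 :=
    (mul_eq_zero.mp h0).resolve_right (pow_ne_zero _ (X_ne_zero j))
  apply hg0
  rw [← constantCoeff_aeval_axisMap j g, hg', map_zero]

/-- The axis law on the deep defect column BY INSTANTIATION of the proved all-`e` law (a PROVED sub-piece of the
blocker 31770: no infinite deep defect walk is an axis tail). [folklore] -/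
theorem noAxisTails_deep :
    ∀ p : ℕ, p.Prime → ∀ e : ℕ, 2 ≤ e → ∀ (K : Type) [Field K] [CharP K p] [PerfectField K] [DecidableEq K]
    (s₀ : State (Fin 3) K), IsRoot (p ^ e) s₀ → ∀ W : ForcedWalk (p ^ e) s₀, (∀ i, 1 ≤ (W.st i).shade) →
    ∀ (N : ℕ) (j : Fin 3), (∀ t, N ≤ t → W.j t = j ∧ W.b t = 0) → False :=
  fun p hp e he K _ _ _ _ s₀ hs W _ N j hN => noAxisTails_holds p hp e (by omega) K s₀ hs W N j hN

end Axis

end Summit.ResolutionOfSingularities.ResolutionOfSingularities.Theorems.ProximityCut
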